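import Summits.HodgeConjecture.HodgeConjecture.Theorems.CyclicUnitaryPowersColourProjectors
import Summits.HodgeConjecture.HodgeConjecture.Theorems.CyclicUnitaryPowersDeckUnitaryGeneration

/-!
# The centre of the connected deck-unitary group: general block scalars, the factorisation `U⁰ = Z · D'`,
# and balanced tensors are fixed by the centre

Helper for stub T `stub_unitaryTorusLemma` of the crux `PowersHodgeOfDeckCommutators` (stmt-HodgeConjecture-19545,
route `CyclicUnitaryPowers`, line `unitary-kunneth-fft` v6, lane 2).  Over a field `K` of characteristic zero with a
primitive `p`-th root `ζ` (`p` odd), for `σ` with `σ ^ p = 1` and a `σ`-invariant form `B` (`U⁰(K) = centIso σ B` of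
`CyclicUnitaryPowersDeckUnitaryGroup`, spectral projectors `P_j`, block scalars `Σ_j λ_j P_j`):

* §1 `blockScalarUnit λ` — the block scalar with invertible scalars `λ_j` as an automorphism of `W`; it lies in
  `U⁰(K)` when `λ_0 = 1` and `λ_j λ_{p-j} = 1` (the centre `Z`), its inverse is the block scalar of `λ⁻¹`, and its
  block determinants are `λ_j ^ dim E_j`;
* §2 **a tensor all of whose non-zero coloured components have balanced colour counts is fixed by `Z`**
  (`tensorSpaceActOver_blockScalarUnit_eq_self_of_balanced`, from `CyclicUnitaryPowersColourProjectors`);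
* §3 **the factorisation `U⁰(K) = Z · D'`** over an algebraically closed `K`: for every `γ ∈ U⁰(K)` there is a central
  `g_λ` with `det ((g_λ⁻¹ γ)|E_j) = 1` for `1 ≤ j ≤ p/2` (`exists_blockScalarUnit_factor`; `λ_j` an `n_j`-th root of
  `det (γ|E_j)`).

Pure linear algebra; no Hodge theory.
-/

noncomputable section

open Module
open scoped TensorProduct BigOperators

namespace Summit.HodgeConjecture.HodgeConjecture.Theorems.CyclicUnitaryPowersDeckUnitaryCentre

open Literature.AlgebraicGeometry.Motives
open Summit.HodgeConjecture.HodgeConjecture.Theorems.CyclicUnitaryPowersSpectralProjectors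
open Summit.HodgeConjecture.HodgeConjecture.Theorems.CyclicUnitaryPowersBlockScalars
open Summit.HodgeConjecture.HodgeConjecture.Theorems.CyclicUnitaryPowersDeckUnitaryGroup
open Summit.HodgeConjecture.HodgeConjecture.Theorems.CyclicUnitaryPowersDeckUnitaryGeneration
open Summit.HodgeConjecture.HodgeConjecture.Theorems.CyclicUnitaryPowersColourProjectors

variable {K : Type*} [Field K] [CharZero K] {W : Type*} [AddCommGroup W] [Module K W]
variable {σ : W →ₗ[K] W} {ζ : K} {p : ℕ} {B : LinearMap.BilinForm K W}

/-! ### §1 General block scalars as automorphisms -/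

/-- **The block scalar `g_λ = Σ_j λ_j P_j` with invertible scalars, as an automorphism** (inverse `g_{λ⁻¹}`).
[folklore] -/
def blockScalarUnit (hσ : σ ^ p = 1) (hζ : IsPrimitiveRoot ζ p) (hp : 0 < p) (lam : ℕ → K) (hlam : ∀ j, lam j ≠ 0) :
    W ≃ₗ[K] W :=
  LinearEquiv.ofLinear (blockScalar σ ζ p lam) (blockScalar σ ζ p fun j => (lam j)⁻¹)
    (by
      change blockScalar σ ζ p lam * blockScalar σ ζ p (fun j => (lam j)⁻¹) = (1 : Module.End K W)
      rw [blockScalar_mul hσ hζ hp, ← blockScalar_one (σ := σ) hζ hp]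
      congr 1; funext j; exact mul_inv_cancel₀ (hlam j))
    (by
      change blockScalar σ ζ p (fun j => (lam j)⁻¹) * blockScalar σ ζ p lam = (1 : Module.End K W)
      rw [blockScalar_mul hσ hζ hp, ← blockScalar_one (σ := σ) hζ hp]
      congr 1; funext j; exact inv_mul_cancel₀ (hlam j))

section Unit

variable (hσ : σ ^ p = 1) (hζ : IsPrimitiveRoot ζ p) (hp : 0 < p) (lam : ℕ → K) (hlam : ∀ j, lam j ≠ 0)

/-- The linear map underlying `g_λ`. [folklore] -/
theorem coe_blockScalarUnit :
    ((blockScalarUnit hσ hζ hp lam hlam : W ≃ₗ[K] W) : W →ₗ[K] W) = blockScalar σ ζ p lam := rfl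

/-- The linear map underlying `g_λ⁻¹` is the block scalar of `λ⁻¹`. [folklore] -/
theorem coe_blockScalarUnit_inv :
    (((blockScalarUnit hσ hζ hp lam hlam)⁻¹ : W ≃ₗ[K] W) : W →ₗ[K] W) = blockScalar σ ζ p fun j => (lam j)⁻¹ := rfl

/-- **`g_λ ∈ U⁰(K)`** for `λ_0 = 1` and `λ_j λ_{p-j} = 1` (`0 < j < p`): the centre of the connected deck-unitary
group. [folklore] -/
theorem blockScalarUnit_mem_centIso (hB : ∀ x y, B (σ x) (σ y) = B x y) (hlam0 : lam 0 = 1)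
    (hrev : ∀ j, 0 < j → j < p → lam j * lam (p - j) = 1) : blockScalarUnit hσ hζ hp lam hlam ∈ centIso σ B := by
  refine ⟨fun x => ?_, fun x y => ?_, fun x hx => ?_⟩
  · change blockScalar σ ζ p lam (σ x) = σ (blockScalar σ ζ p lam x)
    rw [← Module.End.mul_apply, blockScalar_comm, Module.End.mul_apply]
  · exact blockScalar_isometry hσ hζ hp hB lam (by rw [hlam0, one_mul]) hrev x y
  · exact blockScalar_apply_of_fixed hζ hp lam hlam0 hx

variable [FiniteDimensional K W]

/-- Block determinants of `g_λ⁻¹`: `det (g_λ⁻¹|E_j) = (λ_j⁻¹) ^ dim E_j`. [folklore] -/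
theorem det_blockScalarUnit_inv_block {j : ℕ} (hj : j < p) :
    LinearMap.det ((((blockScalarUnit hσ hζ hp lam hlam)⁻¹ : W ≃ₗ[K] W) : W →ₗ[K] W) ∘ₗ specProj σ ζ p j +
        (1 - specProj σ ζ p j)) = (lam j)⁻¹ ^ Module.finrank K ↥(LinearMap.range (specProj σ ζ p j)) := by
  rw [coe_blockScalarUnit_inv]
  exact det_blockScalar_block hσ hζ hp _ hj

end Unit

/-! ### §2 Balanced tensors are fixed by the centre -/

/-- The action of `g_λ` on `T^{r,0}_K W` is the slot operator of the block scalar. [folklore] -/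
theorem tensorSpaceActOver_blockScalarUnit (hσ : σ ^ p = 1) (hζ : IsPrimitiveRoot ζ p) (hp : 0 < p) (lam : ℕ → K)
    (hlam : ∀ j, lam j ≠ 0) {r : ℕ} (x : hodgeTensorSpaceOver K W r 0) :
    tensorSpaceActOver (blockScalarUnit hσ hζ hp lam hlam) x = slotMap (fun _ : Fin r => blockScalar σ ζ p lam) x :=
  tensorSpaceActOver_eq_slotMap_apply _ x

/-- **A tensor whose non-zero coloured components are balanced is fixed by the centre `Z`.** [folklore] -/
theorem tensorSpaceActOver_blockScalarUnit_eq_self_of_balanced (hσ : σ ^ p = 1) (hζ : IsPrimitiveRoot ζ p)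
    (hp : 0 < p) (hodd : Odd p) (lam : ℕ → K) (hlam : ∀ j, lam j ≠ 0) (hlam0 : lam 0 = 1)
    (hrev : ∀ j, 0 < j → j < p → lam j * lam (p - j) = 1) {r : ℕ} {x : hodgeTensorSpaceOver K W r 0}
    (hbal : ∀ c : Fin r → ℕ, (∀ i, c i < p) → colourProj σ ζ p c x ≠ 0 →
      ∀ j ∈ Finset.Ico 1 p, colourCount c j = colourCount c (p - j)) :
    tensorSpaceActOver (blockScalarUnit hσ hζ hp lam hlam) x = x := by
  rw [tensorSpaceActOver_blockScalarUnit]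
  refine slotMap_blockScalar_eq_self_of_forall hζ hp fun c hc => ?_
  by_cases h0 : colourProj σ ζ p c x = 0
  · rw [h0, smul_zero]
  · rw [prod_eq_one_of_balanced hp hodd lam hlam0 hrev c hc (hbal c hc h0), one_smul]

/-! ### §3 The factorisation `U⁰(K) = Z · D'` over an algebraically closed field -/

section Factor

variable [FiniteDimensional K W]

omit [FiniteDimensional K W] in
/-- The block determinants of `γ ∈ U⁰(K)` are non-zero. [folklore] -/
theorem det_block_ne_zero (hσ : σ ^ p = 1) (hζ : IsPrimitiveRoot ζ p) (hp : 0 < p) {γ : W ≃ₗ[K] W}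
    (hγ : γ ∈ centIso σ B) (j : ℕ) :
    LinearMap.det ((γ : W →ₗ[K] W) ∘ₗ specProj σ ζ p j + (1 - specProj σ ζ p j)) ≠ 0 := by
  have h := det_block_mul hσ hζ hp (γ := γ) (δ := γ⁻¹) (inv_mem hγ) j
  rw [mul_inv_cancel] at h
  change LinearMap.det ((1 : Module.End K W) * specProj σ ζ p j + (1 - specProj σ ζ p j)) = _ at h
  rw [one_mul, add_sub_cancel, map_one] at h
  intro h0
  rw [h0, zero_mul] at h
  exact one_ne_zero h

/-- The block determinant of `γ` on a zero block is `1`. [folklore] -/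
theorem det_block_eq_one_of_finrank_eq_zero (hσ : σ ^ p = 1) (hζ : IsPrimitiveRoot ζ p) (hp : 0 < p)
    {γ : W ≃ₗ[K] W} (hγ : γ ∈ centIso σ B) {j : ℕ}
    (h0 : Module.finrank K ↥(LinearMap.range (specProj σ ζ p j)) = 0) :
    LinearMap.det ((γ : W →ₗ[K] W) ∘ₗ specProj σ ζ p j + (1 - specProj σ ζ p j)) = 1 := by
  rw [det_comp_specProj_add hσ hζ hp (γ : W →ₗ[K] W) (LinearMap.ext fun x => hγ.1 x) j]
  exact LinearMap.det_eq_one_of_finrank_eq_zero h0 _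

/-- Roots of the block determinants: `μ_j ≠ 0` with `μ_j ^ dim E_j = det (γ|E_j)`. [folklore] -/
theorem exists_root_det_block [IsAlgClosed K] (hσ : σ ^ p = 1) (hζ : IsPrimitiveRoot ζ p) (hp : 0 < p)
    {γ : W ≃ₗ[K] W} (hγ : γ ∈ centIso σ B) (j : ℕ) :
    ∃ μ : K, μ ≠ 0 ∧ μ ^ Module.finrank K ↥(LinearMap.range (specProj σ ζ p j)) =
      LinearMap.det ((γ : W →ₗ[K] W) ∘ₗ specProj σ ζ p j + (1 - specProj σ ζ p j)) := by
  rcases Nat.eq_zero_or_pos (Module.finrank K ↥(LinearMap.range (specProj σ ζ p j))) with h0 | hpos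
  · exact ⟨1, one_ne_zero, by rw [h0, pow_zero, det_block_eq_one_of_finrank_eq_zero hσ hζ hp hγ h0]⟩
  · obtain ⟨μ, hμ⟩ := IsAlgClosed.exists_pow_nat_eq
      (LinearMap.det ((γ : W →ₗ[K] W) ∘ₗ specProj σ ζ p j + (1 - specProj σ ζ p j))) hpos
    refine ⟨μ, fun hμ0 => ?_, hμ⟩
    rw [hμ0, zero_pow hpos.ne'] at hμ
    exact det_block_ne_zero hσ hζ hp hγ j hμ.symm

/-- **The factorisation `U⁰(K) = Z · D'`**: for `γ ∈ U⁰(K)` (`K` algebraically closed, `p` odd) there is a central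
block scalar `g_λ` (`λ_0 = 1`, `λ_j λ_{p-j} = 1`) such that `g_λ⁻¹ γ` has determinant `1` on every eigenblock `E_j`,
`1 ≤ j ≤ p/2`. [folklore] -/
theorem exists_blockScalarUnit_factor [IsAlgClosed K] (hσ : σ ^ p = 1) (hζ : IsPrimitiveRoot ζ p) (hp : 0 < p)
    (hodd : Odd p) {γ : W ≃ₗ[K] W} (hγ : γ ∈ centIso σ B) :
    ∃ (lam : ℕ → K) (hlam : ∀ j, lam j ≠ 0), lam 0 = 1 ∧ (∀ j, 0 < j → j < p → lam j * lam (p - j) = 1) ∧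
      ∀ j, 1 ≤ j → j ≤ p / 2 →
        LinearMap.det (((((blockScalarUnit hσ hζ hp lam hlam)⁻¹ * γ : W ≃ₗ[K] W)) : W →ₗ[K] W) ∘ₗ
            specProj σ ζ p j + (1 - specProj σ ζ p j)) = 1 := by
  choose μ hμ0 hμ using fun j => exists_root_det_block hσ hζ hp hγ j
  obtain ⟨m, hm⟩ := hodd
  have hdiv : p / 2 = m := by omega
  let lam : ℕ → K := fun j => if j = 0 then 1 else if j ≤ p / 2 then μ j else (μ (p - j))⁻¹
  have hlam : ∀ j, lam j ≠ 0 := by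
    intro j
    simp only [lam]
    split_ifs with h1 h2
    · exact one_ne_zero
    · exact hμ0 j
    · exact inv_ne_zero (hμ0 (p - j))
  refine ⟨lam, hlam, by simp [lam], fun j hj0 hjp => ?_, fun j hj1 hjh => ?_⟩
  · have hj : j ≠ 0 := by omega
    have hpj : p - j ≠ 0 := by omega
    by_cases hjm : j ≤ p / 2
    · have h3 : ¬ (p - j ≤ p / 2) := by omega
      have h4 : p - (p - j) = j := by omega
      simp only [lam, if_neg hj, if_pos hjm, if_neg hpj, if_neg h3, h4]
      exact mul_inv_cancel₀ (hμ0 j)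
    · have h3 : p - j ≤ p / 2 := by omega
      simp only [lam, if_neg hj, if_neg hjm, if_neg hpj, if_pos h3]
      exact inv_mul_cancel₀ (hμ0 (p - j))
  · have hj : j ≠ 0 := by omega
    have hjp : j < p := by omega
    rw [det_block_mul hσ hζ hp hγ j, det_blockScalarUnit_inv_block hσ hζ hp lam hlam hjp]
    simp only [lam, if_neg hj, if_pos hjh]
    rw [inv_pow, hμ j, inv_mul_cancel₀ (det_block_ne_zero hσ hζ hp hγ j)]

end Factor

end Summit.HodgeConjecture.HodgeConjecture.Theorems.CyclicUnitaryPowersDeckUnitaryCentre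

end
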